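import Literature.Analysis.InverseSpectral.KreinString
import Literature.Analysis.InverseSpectral.KreinStringProofs
import Literature.Analysis.InverseSpectral.KreinStringPositivity
import HarnessLib

/-!
# Stub `stub_phiMono` — monotonicity of `φ(·, -σ)` in the mass
(crux `LeeYang.LeeyangThesis`, line Sketch, card telegraph-string)

If a Kreĭn string `T` carries no more mass than `S` on `(-∞, x]`
(`dm_T|(-∞,x] ≤ dm_S|(-∞,x]`, `x ∈ [0, L_S) ∩ [0, L_T)`) then `φ_T(t, -σ) ≤ φ_S(t, -σ)` for every
`σ ≥ 0` and `0 ≤ t ≤ x`.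

Proof. At `z = -σ` the Picard series `φ(t, -σ) = Σₙ σⁿ φₙ(t)` is a convergent real series with
non-negative terms (`KreinString.phi_neg_re`, `KreinString.summable_picard_neg`,
`KreinString.picard_nonneg`). Each Picard iterate `φₙ₊₁(t) = ∫_{[0,t]} (t - s) φₙ(s) dm(s)`
(`KreinString.picard_succ`) has a non-negative integrand on `[0, t]`, so it is monotone both in the
integrand (induction hypothesis, `setIntegral_mono_on`) and in the measure
(`integral_mono_measure`, after restricting the mass comparison from `(-∞, x]` to `[0, t]`).
Termwise comparison of the two series (`Summable.tsum_le_tsum`) finishes.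
-/

noncomputable section

set_option linter.dupNamespace false

open MeasureTheory Filter Topology Complex
open scoped ENNReal

namespace Summit.RiemannHypothesis.RiemannHypothesis.Theorems.LeeYangTelegraphString

open Literature.Analysis.InverseSpectral

/-- A comparison of two measures restricted to `(-∞, x]` restricts further to `[0, t]`, `t ≤ x`. -/
private lemma restrict_Icc_le_of_restrict_Iic_le {μ ν : Measure ℝ} {x t : ℝ}
    (h : μ.restrict (Set.Iic x) ≤ ν.restrict (Set.Iic x)) (ht : t ≤ x) :
    μ.restrict (Set.Icc 0 t) ≤ ν.restrict (Set.Icc 0 t) := by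
  have hsub : Set.Icc 0 t ⊆ Set.Iic x := fun s hs => hs.2.trans ht
  rw [← Measure.restrict_restrict_of_subset (μ := μ) hsub,
    ← Measure.restrict_restrict_of_subset (μ := ν) hsub]
  exact Measure.restrict_mono_measure h _

/-- The Picard iterates `φₙ = Kⁿ 1` are monotone in the mass: if `dm_T ≤ dm_S` on `(-∞, x]` then
`φₙ^T(t) ≤ φₙ^S(t)` for `0 ≤ t ≤ x` (induction on `n`; the kernel `(t - s) φₙ(s)` is non-negative
on `[0, t]`). -/
private lemma picard_one_le_of_restrict_le (S T : KreinString) {x : ℝ} (hxS : x ∈ S.dom)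
    (hxT : x ∈ T.dom)
    (h : T.massMeasure.restrict (Set.Iic x) ≤ S.massMeasure.restrict (Set.Iic x)) (n : ℕ) :
    ∀ {t : ℝ}, t ∈ Set.Icc 0 x →
      T.picard (fun _ => (1 : ℝ)) n t ≤ S.picard (fun _ => (1 : ℝ)) n t := by
  induction n with
  | zero => intro t _; simp
  | succ n ih =>
    intro t ht
    have htS : t ∈ S.dom := S.Icc_subset_dom hxS ht
    have htT : t ∈ T.dom := T.Icc_subset_dom hxT ht
    have hsub : Set.Icc 0 t ⊆ Set.Icc 0 x := Set.Icc_subset_Icc_right ht.2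
    have hcS : ContinuousOn (fun s => (t - s) * S.picard (fun _ => (1 : ℝ)) n s) (Set.Icc 0 t) :=
      (continuousOn_const.sub continuousOn_id).mul
        ((S.continuousOn_picard hxS continuousOn_const n).mono hsub)
    have hcT : ContinuousOn (fun s => (t - s) * T.picard (fun _ => (1 : ℝ)) n s) (Set.Icc 0 t) :=
      (continuousOn_const.sub continuousOn_id).mul
        ((T.continuousOn_picard hxT continuousOn_const n).mono hsub)
    have h0 : ∀ s ∈ Set.Icc 0 t, 0 ≤ (t - s) * S.picard (fun _ => (1 : ℝ)) n s := fun s hs =>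
      mul_nonneg (sub_nonneg.2 hs.2) (S.picard_nonneg (fun _ _ => zero_le_one) n hs.1)
    rw [KreinString.picard_succ, KreinString.picard_succ]
    calc ∫ s in Set.Icc 0 t, (t - s) * T.picard (fun _ => (1 : ℝ)) n s ∂T.massMeasure
        ≤ ∫ s in Set.Icc 0 t, (t - s) * S.picard (fun _ => (1 : ℝ)) n s ∂T.massMeasure :=
          setIntegral_mono_on (T.integrableOn_Icc_of_continuousOn htT hcT)
            (T.integrableOn_Icc_of_continuousOn htT hcS) measurableSet_Icc
            (fun s hs => mul_le_mul_of_nonneg_left (ih ⟨hs.1, hs.2.trans ht.2⟩)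
              (sub_nonneg.2 hs.2))
      _ ≤ ∫ s in Set.Icc 0 t, (t - s) * S.picard (fun _ => (1 : ℝ)) n s ∂S.massMeasure :=
          integral_mono_measure (restrict_Icc_le_of_restrict_Iic_le h ht.2)
            (ae_restrict_of_forall_mem measurableSet_Icc h0)
            (S.integrableOn_Icc_of_continuousOn htS hcS)

/-- **Stub phiMono — monotonicity of `φ(·, -σ)` in the mass.** If `T` carries no more mass than `S`
on `(-∞, x]` (`x ∈ [0, L_S) ∩ [0, L_T)`) then `φ_T(t, -σ) ≤ φ_S(t, -σ)` for `σ ≥ 0`, `0 ≤ t ≤ x`: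
both sides are the real series `Σₙ σⁿ φₙ(t)` (`KreinString.phi_neg_re`), whose terms are iterated
integrals of non-negative kernels against the mass measure on `[0, t]`, hence monotone in it. -/
theorem stub_phiMono : ∀ (S T : KreinString) (x : ℝ), x ∈ S.dom → x ∈ T.dom →
    T.massMeasure.restrict (Set.Iic x) ≤ S.massMeasure.restrict (Set.Iic x) →
    ∀ σ : ℝ, 0 ≤ σ → ∀ t ∈ Set.Icc 0 x, (T.phi (-(σ : ℂ)) t).re ≤ (S.phi (-(σ : ℂ)) t).re := by
  intro S T x hxS hxT h σ hσ t ht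
  rw [KreinString.phi_neg_re, KreinString.phi_neg_re]
  exact Summable.tsum_le_tsum
    (fun n => mul_le_mul_of_nonneg_left (picard_one_le_of_restrict_le S T hxS hxT h n ht)
      (pow_nonneg hσ n))
    (T.summable_picard_neg continuous_const σ (T.Icc_subset_dom hxT ht))
    (S.summable_picard_neg continuous_const σ (S.Icc_subset_dom hxS ht))

end Summit.RiemannHypothesis.RiemannHypothesis.Theorems.LeeYangTelegraphString

end
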